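import Mathlib.NumberTheory.NumberField.CanonicalEmbedding.Basic
import Mathlib.NumberTheory.NumberField.Discriminant.Defs
import Mathlib.RingTheory.DedekindDomain.Different
import Mathlib.Analysis.Distribution.SchwartzSpace.Basic
import Mathlib.Analysis.Fourier.FourierTransform
import Mathlib.Algebra.Module.ZLattice.Summable
import Literature.Algebra.EuclideanLattices.DualLattice
import HarnessLib

/-!
# Theta series of ideal lattices and the Poisson summation formula (Hecke's continuation of `ζ_K`, I)

Topic `Literature/NumberTheory/LFunctions`, next to `DedekindZeta.lean`. That file states Hecke's
theorem `Literature.exists_isDedekindZetaContinuation K` (the Dedekind zeta function continues to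
`ℂ ∖ {1}`; Neukirch, *Algebraic Number Theory*, Ch. VII, (5.11) Corollary (i)) as a named fact, on
which `Literature.NumberField.extendedRiemannHypothesis_iff' K` rests
(`Literature.NumberTheory.LFunctions.NumberField.extendedRiemannHypothesis_iff'_of_exists`, `DedekindZetaProofs.lean`). This file
vendors the two *analytic inputs* of Neukirch's proof of (5.11) (Ch. VII §3 and §5) as named facts,
in the form in which the proof consumes them, together with the definitions they need:

* `Literature.NumberTheory.LFunctions.poissonSummation_zlattice` (FACT, VII (3.2) *Poisson summation formula*), stated with the
  dual lattice `Γ' = {g' | ⟨g', g⟩ ∈ ℤ for all g ∈ Γ}` of `Literature/Algebra/EuclideanLattices`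
  (`Literature.Lattice.dualLattice Γ`, `Literature.Algebra.EuclideanLattices.mem_dualLattice`): `∑_{g ∈ Γ} f(g) = vol(Γ)⁻¹ ∑_{g' ∈ Γ'} f̂(g')` for every
  Schwartz function `f`, `vol(Γ)` the covolume (Mathlib `ZLattice.covolume`, for the Haar measure
  giving an orthonormal cube volume `1`, which is Mathlib's `volume` on an inner product space) and
  `f̂(y) = ∫ f(x) e^{-2πi⟨x,y⟩} dx` (Mathlib `𝓕`, `Real.fourier_eq`). Mathlib has the case `V = ℝ`,
  `Γ = ℤ` only (`SchwartzMap.tsum_eq_tsum_fourier`).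
* `Literature.NumberField.thetaIdeal K I y` — the theta series `θ_𝔞(iy) = ∑_{a ∈ 𝔞} e^{-π⟨ay, a⟩}`,
  `⟨ay, a⟩ = ∑_τ y_τ |τa|² = ∑_w e_w y_w |a|_w²` of a fractional ideal `𝔞 = I` of `K`, viewed as
  the lattice `j(𝔞)` of the Minkowski space `K_ℝ`, at the point `z = iy` of the upper half-space,
  `y ∈ R_+^*` (Neukirch VII (3.4) Definition with `Γ = 𝔞`, `p = 0`, `a = b = 0`, as used in §5 before (5.5)); here
  `w` runs over the infinite places, `e_w = mult w ∈ {1, 2}` and `|a|_w = w a`;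
  `Literature.NumberField.mixedNorm y = N(y) = ∏_τ y_τ = ∏_w y_w^{e_w}`.
* `Literature.NumberTheory.LFunctions.NumberField.summable_thetaIdeal` (VII (3.5) Proposition for `Γ = 𝔞`, `z = iy`): the theta
  series converges absolutely for `y > 0`; PROVED here (`summable_thetaIdeal_holds`) from Mathlib's
  lattice `p`-series `ZLattice.summable_norm_rpow` on the ideal lattice `j(𝔞) ⊂ K_ℝ`.
* `Literature.NumberTheory.LFunctions.NumberField.thetaIdeal_inv` (FACT, VII (3.6) *Theta transformation formula*
  `θ_Γ(-1/z) = √N(z/i) / vol(Γ) · θ_{Γ'}(z)` for `Γ = 𝔞`, `z = iy`, with (5.7) Lemma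
  `*Γ' = (𝔞𝔡)⁻¹` and `vol(𝔞) = 𝔑(𝔞) |d_K|^{1/2}` (Ch. I (5.2)), exactly as combined in the proof of
  VII (5.8)): `θ_𝔞(i y⁻¹) = N(y)^{1/2} / (𝔑(𝔞) √|d_K|) · θ_{(𝔞𝔡)⁻¹}(iy)`. The dual ideal
  `(𝔞𝔡)⁻¹ = {x ∈ K | Tr(x𝔞) ⊆ ℤ}` is Mathlib's `FractionalIdeal.dual ℤ ℚ I`
  (`FractionalIdeal.mem_dual`; `FractionalIdeal.dual_eq_mul_inv`, `coeIdeal_differentIdeal`).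

Also proved here: positivity and the trivial bounds of the theta summands, `thetaIdeal` of the zero ideal, and the comparison
`δ ‖x‖² ≤ ⟨xy, x⟩` (`mul_norm_sq_le_sum_mult_mul`) behind the convergence proof.

## How these feed (5.11) (i) (plan; the remaining steps are proofs, kept in `DedekindZetaProofs`)

Neukirch's route (VII (5.5)–(5.10)) integrates `θ_𝔞` over a fundamental domain `F` of the unit
group in the norm-one hypersurface `S` and applies the Mellin principle (1.4) (Mathlib's
`WeakFEPair`). In coordinates `(c, t) ∈ ℝ^{r-1} × ℝ_+^*` of `F × ℝ_+^*` given by a fundamental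
system of units `u_1, …, u_{r-1}` (Mathlib `NumberField.Units.fundSystem`),
`y(c, t)_w = t^{1/n} ∏_i |u_i|_w^{2c_i}`, the unit action is integer translation of `c`,
`N(y(c,t)) = t`, `y(c, 1/t) = y(-c, t)⁻¹`, and `thetaIdeal_inv` turns
`f(t) = ∫_{[0,1]^{r-1}} θ_𝔞(i y(c,t)) dc` into a weak FE-pair of weight `1/2`; the Mellin transform of
`f - 1` unfolds (VII (5.5)) to `Γ`-factors times the partial zeta function of the class of `𝔞⁻¹`
(VII (5.3), (5.4)), and summing over the class group gives (5.10), (5.11).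

## References

* J. Neukirch, *Algebraic Number Theory*, Grundlehren 322, Springer 1999: Ch. VII §3, (3.2) Poisson
  summation formula, (3.4) Definition, (3.5) Proposition, (3.6) Theta transformation formula;
  Ch. VII §5, (5.3)–(5.5), (5.7) Lemma, (5.8) Proposition and its proof, (5.11) Corollary; Ch. I (5.2).
  PDF pages 392–410 of the held copy `book:bynd-algebraic-number-theory`.
  [NeukirchANT1999]
* E. Hecke, *Über die Zetafunktion beliebiger algebraischer Zahlkörper*, Nachr. Ges. Wiss.
  Göttingen (1917), 77–89. [Hecke1917]
-/

noncomputable section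

open scoped FourierTransform SchwartzMap RealInnerProductSpace NumberField nonZeroDivisors
open NumberField NumberField.InfinitePlace MeasureTheory

universe u

namespace Literature.NumberTheory.LFunctions

/-! ## The Poisson summation formula (Neukirch VII (3.2))

The dual lattice `Γ' = {g' ∈ V | ⟨g', g⟩ ∈ ℤ for all g ∈ Γ}` of Neukirch VII (3.2) is
`Literature.Lattice.dualLattice Γ` (`Literature/Algebra/EuclideanLattices/DualLattice.lean`, with
`mem_dualLattice`, the `IsZLattice` instance and `covolume_dualLattice`). -/

section Poisson

/-- **Poisson summation formula** (NAMED FACT; Neukirch VII (3.2)): let `Γ` be a complete lattice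
in the euclidean vector space `V` and `Γ'` the dual lattice. Then for any
Schwartz function `f` on `V`, `∑_{g ∈ Γ} f(g) = vol(Γ)⁻¹ ∑_{g' ∈ Γ'} f̂(g')`, where
`Γ' = Literature.Lattice.dualLattice Γ` and `vol(Γ)` is the
volume of a fundamental mesh of `Γ` for the Haar measure `dx` giving volume `1` to the cube spanned
by an orthonormal basis (Mathlib: `volume` on a finite-dimensional inner product space,
`ZLattice.covolume Γ`), and `f̂(y) = ∫_V f(x) e^{-2πi⟨x,y⟩} dx` (Mathlib `𝓕 f`, `Real.fourier_eq`).
Mathlib proves the case `V = ℝ`, `Γ = ℤ` (`SchwartzMap.tsum_eq_tsum_fourier`). Both series converge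
absolutely (Schwartz decay), so the `tsum`s below are sums. [cite: NeukirchANT1999, Ch. VII (3.2)] -/
def poissonSummation_zlattice : Prop :=
  ∀ (V : Type u) [NormedAddCommGroup V] [InnerProductSpace ℝ V] [FiniteDimensional ℝ V]
    [MeasurableSpace V] [BorelSpace V] (Γ : Submodule ℤ V) [DiscreteTopology Γ] [IsZLattice ℝ Γ]
    (f : 𝓢(V, ℂ)),
    ∑' g : Γ, f g = ((ZLattice.covolume Γ)⁻¹ : ℝ) • ∑' g' : Literature.Algebra.EuclideanLattices.dualLattice Γ, 𝓕 (⇑f) g'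

end Poisson

/-! ## Theta series of ideals of a number field (Neukirch VII (3.4), §5) -/

namespace NumberField

variable (K : Type*) [Field K] [NumberField K]

/-- The norm `N(y) = ∏_τ y_τ = ∏_w y_w^{e_w}` of a point `y` of `R_+^* = [∏_τ ℝ_+^*]^+`, written in
coordinates indexed by the infinite places `w` (`e_w = mult w`, i.e. `1` for real and `2` for complex
`w`) (Neukirch VII §3, notation before (3.1): `N(z) = ∏_τ z_τ`). [cite: NeukirchANT1999, Ch. VII §3] -/
def mixedNorm (y : InfinitePlace K → ℝ) : ℝ :=
  ∏ w : InfinitePlace K, y w ^ mult w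

/-- Neukirch's hermitian form evaluated on an element of `K` scaled by `y ∈ R_±`:
`⟨ay, a⟩ = ∑_τ y_τ |τ a|² = ∑_w e_w y_w |a|_w²` (`|a|_w = w a`, `e_w = mult w`; Neukirch VII §3,
notation before (3.1), `⟨x, y⟩ = ∑_τ x_τ ȳ_τ`, and §5 before (5.5), `⟨ay, a⟩`).
[cite: NeukirchANT1999, Ch. VII §3] -/
def minkowskiQuadForm (y : InfinitePlace K → ℝ) (a : K) : ℝ :=
  ∑ w : InfinitePlace K, (mult w : ℝ) * y w * (w a) ^ 2

/-- The summand `e^{-π⟨ay, a⟩}` of the theta series of an ideal at `z = iy`. [folklore] -/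
def thetaSummand (y : InfinitePlace K → ℝ) (a : K) : ℝ :=
  Real.exp (-Real.pi * minkowskiQuadForm K y a)

/-- The **theta series of a fractional ideal** `𝔞 = I` of `K` at the point `z = iy` of the upper
half-space, `y ∈ R_+^*`: `θ_𝔞(iy) = ∑_{a ∈ 𝔞} e^{πi⟨a·iy, a⟩} = ∑_{a ∈ 𝔞} e^{-π ∑_w e_w y_w |a|_w²}`
(Neukirch VII (3.4) Definition, for the complete lattice `Γ = j(𝔞) ⊂ K_ℝ`, `p = 0`, `a = b = 0`;
§5 before (5.5)). Defined as a `tsum` (the series converges for `y > 0`, `summable_thetaIdeal`).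
[cite: NeukirchANT1999, Ch. VII (3.4)] -/
def thetaIdeal (I : FractionalIdeal (𝓞 K)⁰ K) (y : InfinitePlace K → ℝ) : ℝ :=
  ∑' a : I, thetaSummand K y (a : K)

variable {K}

/-- `⟨ay, a⟩ ≥ 0` for `y ≥ 0`. [folklore] -/
theorem minkowskiQuadForm_nonneg {y : InfinitePlace K → ℝ} (hy : ∀ w, 0 ≤ y w) (a : K) :
    0 ≤ minkowskiQuadForm K y a :=
  Finset.sum_nonneg fun w _ ↦ by have := hy w; positivity

/-- `⟨0·y, 0⟩ = 0`. [folklore] -/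
@[simp] theorem minkowskiQuadForm_zero (y : InfinitePlace K → ℝ) : minkowskiQuadForm K y 0 = 0 := by
  simp [minkowskiQuadForm]

/-- Every summand `e^{-π⟨ay,a⟩}` of the theta series is positive. [folklore] -/
theorem thetaSummand_pos (y : InfinitePlace K → ℝ) (a : K) : 0 < thetaSummand K y a :=
  Real.exp_pos _

/-- The summand at `a = 0` is `1`. [folklore] -/
@[simp] theorem thetaSummand_zero (y : InfinitePlace K → ℝ) : thetaSummand K y 0 = 1 := by
  simp [thetaSummand]

/-- For `y ≥ 0` every summand of the theta series is at most `1`. [folklore] -/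
theorem thetaSummand_le_one {y : InfinitePlace K → ℝ} (hy : ∀ w, 0 ≤ y w) (a : K) :
    thetaSummand K y a ≤ 1 := by
  rw [thetaSummand, Real.exp_le_one_iff, neg_mul, neg_nonpos]
  exact mul_nonneg Real.pi_pos.le (minkowskiQuadForm_nonneg hy a)

/-- `θ_𝔞(iy) ≥ 0` (a `tsum` of positive terms; `0` if not summable). [folklore] -/
theorem thetaIdeal_nonneg (I : FractionalIdeal (𝓞 K)⁰ K) (y : InfinitePlace K → ℝ) :
    0 ≤ thetaIdeal K I y :=
  tsum_nonneg fun a ↦ (thetaSummand_pos y a).le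

/-- The theta series of the zero fractional ideal is `1` (only the term `a = 0`). [folklore] -/
theorem thetaIdeal_zero (y : InfinitePlace K → ℝ) : thetaIdeal K 0 y = 1 := by
  rw [thetaIdeal]
  have : ∀ a : (0 : FractionalIdeal (𝓞 K)⁰ K), (a : K) = 0 := fun a ↦
    (FractionalIdeal.mem_zero_iff (𝓞 K)⁰).mp a.2
  simp_rw [this, thetaSummand_zero]
  haveI : Unique (0 : FractionalIdeal (𝓞 K)⁰ K) :=
    ⟨⟨⟨0, FractionalIdeal.zero_mem _⟩⟩, fun a ↦ Subtype.ext ((this a).trans (this _).symm)⟩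
  exact tsum_const _ |>.trans (by simp)

variable (K)

/-- A Gaussian is dominated by negative powers: `e^{-x} ≤ k! · x^{-k}` for `x > 0`, from
`x^k / k! ≤ e^x` (Mathlib `Real.pow_div_factorial_le_exp`). [folklore] -/
theorem exp_neg_le_factorial_mul_inv_pow {x : ℝ} (hx : 0 < x) (k : ℕ) :
    Real.exp (-x) ≤ k.factorial * x⁻¹ ^ k := by
  have h := Real.pow_div_factorial_le_exp (x := x) hx.le k
  rw [div_le_iff₀ (by positivity)] at h
  rw [Real.exp_neg, inv_pow, ← div_eq_mul_inv, le_div_iff₀ (by positivity),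
    inv_mul_le_iff₀ (Real.exp_pos _)]
  linarith

/-! ### The Gaussian `e^{-π⟨xy, x⟩}` on the Minkowski space and the ideal lattice `j(𝔞)`

Neukirch's proof of (3.5) bounds the general term of the theta series by a Gaussian in the
coefficients with respect to a `ℤ`-basis of `Γ` and sums a lattice-point count. We run the same
comparison through Mathlib's Minkowski space `mixedSpace K` (sup norm `‖x‖ = max_w |x|_w`,
`norm_eq_sup'_normAtPlace`) and its lattice `p`-series `ZLattice.summable_norm_rpow`: for
`y ≥ δ > 0` the Gaussian at `x ≠ 0` is at most `e^{-πδ‖x‖²} ≤ k! (πδ)^{-k} ‖x‖^{-2k}`, and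
`∑_{x ∈ j(𝔞)} ‖x‖^{-2k} < ∞` for `2k > n`. This gives both the convergence (3.5) and the decay
`θ_𝔞(iy) - 1 = O(δ^{-k})` (every `k > n/2`) used for the Mellin transform in §5 ((5.8), second
formula, in polynomial form). -/

open scoped Classical in
/-- The Gaussian `x ↦ e^{-π ∑_w e_w y_w |x|_w²}` on the Minkowski space `K_ℝ = mixedSpace K`
(`|x|_w = normAtPlace w x`); at `x = j(a)` it is the theta summand `e^{-π⟨ay, a⟩}`
(`thetaSummand_eq_mixedGaussian`). [folklore] -/
def mixedGaussian (y : InfinitePlace K → ℝ) (x : mixedEmbedding.mixedSpace K) : ℝ :=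
  Real.exp (-Real.pi * ∑ w, (mult w : ℝ) * y w * mixedEmbedding.normAtPlace w x ^ 2)

open scoped Classical in
/-- `e^{-π⟨ay,a⟩}` is the Minkowski-space Gaussian at `j(a)` (`|j(a)|_w = w a`,
Mathlib `normAtPlace_apply`). [folklore] -/
theorem thetaSummand_eq_mixedGaussian (y : InfinitePlace K → ℝ) (a : K) :
    thetaSummand K y a = mixedGaussian K y (mixedEmbedding K a) := by
  simp [thetaSummand, mixedGaussian, minkowskiQuadForm, mixedEmbedding.normAtPlace_apply]

open scoped Classical in
/-- The Minkowski-space Gaussian is positive. [folklore] -/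
theorem mixedGaussian_pos (y : InfinitePlace K → ℝ) (x : mixedEmbedding.mixedSpace K) :
    0 < mixedGaussian K y x :=
  Real.exp_pos _

open scoped Classical in
/-- The Gaussian is antitone in `y`: `y ≤ y'` coordinatewise gives
`e^{-π⟨xy', x⟩} ≤ e^{-π⟨xy, x⟩}`. [folklore] -/
theorem mixedGaussian_le_mixedGaussian {y y' : InfinitePlace K → ℝ} (h : ∀ w, y w ≤ y' w)
    (x : mixedEmbedding.mixedSpace K) : mixedGaussian K y' x ≤ mixedGaussian K y x := by
  refine Real.exp_le_exp.mpr ?_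
  rw [neg_mul, neg_mul, neg_le_neg_iff]
  refine mul_le_mul_of_nonneg_left (Finset.sum_le_sum fun w _ ↦ ?_) Real.pi_pos.le
  have := mixedEmbedding.normAtPlace_nonneg w x
  have : (0 : ℝ) ≤ mult w := by positivity
  gcongr
  exact h w

open scoped Classical in
/-- Neukirch's form dominates the sup norm of the Minkowski space: for `y ≥ δ ≥ 0` coordinatewise,
`δ ‖x‖² ≤ ∑_w e_w y_w |x|_w²` (`‖x‖ = max_w |x|_w`, Mathlib `norm_eq_sup'_normAtPlace`). [folklore] -/
theorem mul_norm_sq_le_sum_mult_mul {y : InfinitePlace K → ℝ} {δ : ℝ} (hδ : 0 ≤ δ)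
    (hy : ∀ w, δ ≤ y w) (x : mixedEmbedding.mixedSpace K) :
    δ * ‖x‖ ^ 2 ≤ ∑ w, (mult w : ℝ) * y w * mixedEmbedding.normAtPlace w x ^ 2 := by
  obtain ⟨w₁, -, hw₁⟩ := Finset.exists_mem_eq_sup' Finset.univ_nonempty
    (fun w ↦ mixedEmbedding.normAtPlace w x)
  rw [mixedEmbedding.norm_eq_sup'_normAtPlace, hw₁]
  have hy0 : ∀ w, 0 ≤ y w := fun w ↦ hδ.trans (hy w)
  calc δ * mixedEmbedding.normAtPlace w₁ x ^ 2
      ≤ (mult w₁ : ℝ) * y w₁ * mixedEmbedding.normAtPlace w₁ x ^ 2 := by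
        gcongr
        calc δ ≤ y w₁ := hy w₁
          _ = 1 * y w₁ := (one_mul _).symm
          _ ≤ mult w₁ * y w₁ := by
            gcongr
            · exact hy0 w₁
            · exact_mod_cast one_le_mult
    _ ≤ ∑ w, (mult w : ℝ) * y w * mixedEmbedding.normAtPlace w x ^ 2 :=
        Finset.single_le_sum (f := fun w ↦ (mult w : ℝ) * y w * mixedEmbedding.normAtPlace w x ^ 2)
          (fun w _ ↦ by have := hy0 w; positivity) (Finset.mem_univ w₁)

open scoped Classical in
/-- **Gaussian versus negative powers on the Minkowski space**: for `y ≥ δ > 0` and `x ≠ 0`,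
`e^{-π⟨xy,x⟩} ≤ k! (πδ)^{-k} ‖x‖^{-2k}`. [folklore] -/
theorem mixedGaussian_le_mul_norm_rpow {y : InfinitePlace K → ℝ} {δ : ℝ} (hδ : 0 < δ)
    (hy : ∀ w, δ ≤ y w) {x : mixedEmbedding.mixedSpace K} (hx : x ≠ 0) (k : ℕ) :
    mixedGaussian K y x ≤ (k.factorial : ℝ) * (Real.pi * δ)⁻¹ ^ k * ‖x‖ ^ (-((2 * k : ℕ) : ℝ)) := by
  have hxpos : 0 < ‖x‖ := norm_pos_iff.mpr hx
  have hq := mul_norm_sq_le_sum_mult_mul (K := K) hδ.le hy x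
  have hpos : 0 < Real.pi * δ * ‖x‖ ^ 2 := by positivity
  calc mixedGaussian K y x ≤ Real.exp (-(Real.pi * δ * ‖x‖ ^ 2)) := by
        apply Real.exp_le_exp.mpr
        rw [neg_mul, neg_le_neg_iff, mul_assoc]
        exact mul_le_mul_of_nonneg_left hq Real.pi_pos.le
    _ ≤ k.factorial * (Real.pi * δ * ‖x‖ ^ 2)⁻¹ ^ k := exp_neg_le_factorial_mul_inv_pow hpos k
    _ = (k.factorial : ℝ) * (Real.pi * δ)⁻¹ ^ k * ‖x‖ ^ (-((2 * k : ℕ) : ℝ)) := by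
        rw [Real.rpow_neg (norm_nonneg _), Real.rpow_natCast, mul_inv, mul_pow, pow_mul,
          inv_pow, inv_pow, mul_assoc]

open scoped Classical in
/-- The lattice `p`-series on an ideal lattice: `∑_{x ∈ j(𝔞)} ‖x‖^{-2k}` converges for `2k > n`
(Mathlib `ZLattice.summable_norm_rpow`, `rank j(𝔞) = n`). [folklore] -/
theorem summable_norm_rpow_idealLattice (I : (FractionalIdeal (𝓞 K)⁰ K)ˣ) {k : ℕ}
    (hk : Module.finrank ℚ K < 2 * k) :
    Summable fun x : mixedEmbedding.idealLattice K I ↦ ‖x‖ ^ (-((2 * k : ℕ) : ℝ)) := by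
  refine ZLattice.summable_norm_rpow _ _ ?_
  rw [ZLattice.rank ℝ (mixedEmbedding.idealLattice K I), mixedEmbedding.finrank]
  have : ((Module.finrank ℚ K : ℕ) : ℝ) < ((2 * k : ℕ) : ℝ) := Nat.cast_lt.mpr hk
  linarith

open scoped Classical in
/-- **The Gaussian is summable over an ideal lattice** for `y > 0` (the content of Neukirch
VII (3.5) for `Γ = 𝔞`, `z = iy`). [cite: NeukirchANT1999, Ch. VII (3.5)] -/
theorem summable_mixedGaussian_idealLattice (I : (FractionalIdeal (𝓞 K)⁰ K)ˣ)
    {y : InfinitePlace K → ℝ} (hy : ∀ w, 0 < y w) :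
    Summable fun x : mixedEmbedding.idealLattice K I ↦
      mixedGaussian K y (x : mixedEmbedding.mixedSpace K) := by
  set L := mixedEmbedding.idealLattice K I
  -- `δ = min_w y_w > 0`
  obtain ⟨w₀, -, hw₀⟩ := Finset.exists_min_image Finset.univ y Finset.univ_nonempty
  have hδ : 0 < y w₀ := hy w₀
  have hδle : ∀ w, y w₀ ≤ y w := fun w ↦ hw₀ w (Finset.mem_univ w)
  obtain ⟨k, hk⟩ : ∃ k : ℕ, Module.finrank ℚ K < 2 * k := ⟨Module.finrank ℚ K, by
    have : 0 < Module.finrank ℚ K := Module.finrank_pos; omega⟩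
  refine Summable.of_norm_bounded_eventually
    ((summable_norm_rpow_idealLattice K I hk).mul_left
      ((k.factorial : ℝ) * (Real.pi * y w₀)⁻¹ ^ k)) ?_
  refine Filter.eventually_cofinite.mpr ((Set.finite_singleton (0 : L)).subset fun x hx ↦ ?_)
  rw [Set.mem_singleton_iff]
  by_contra hx0
  refine hx ?_
  rw [Real.norm_of_nonneg (mixedGaussian_pos K y _).le]
  exact mixedGaussian_le_mul_norm_rpow K hδ hδle (fun h ↦ hx0 (Subtype.ext h)) k

open scoped Classical in
/-- **Decay of the lattice Gaussian sum off the origin**: for `2k > n` there is `C` (depending on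
`𝔞, k`) with `∑_{x ∈ j(𝔞), x ≠ 0} e^{-π⟨xy,x⟩} ≤ C δ^{-k}` whenever `y ≥ δ > 0` coordinatewise
(polynomial form of the estimate `θ - 1 = O(e^{-ct^{1/n}})` in the proof of Neukirch VII (5.8)).
[folklore] -/
theorem tsum_mixedGaussian_idealLattice_sub_one_le (I : (FractionalIdeal (𝓞 K)⁰ K)ˣ) {k : ℕ}
    (hk : Module.finrank ℚ K < 2 * k) :
    ∃ C : ℝ, ∀ (δ : ℝ) (_ : 0 < δ) (y : InfinitePlace K → ℝ) (_ : ∀ w, δ ≤ y w),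
      ∑' x : mixedEmbedding.idealLattice K I, mixedGaussian K y (x : mixedEmbedding.mixedSpace K)
        - 1 ≤ C * δ⁻¹ ^ k := by
  set L := mixedEmbedding.idealLattice K I
  set S : ℝ := ∑' x : L, ‖x‖ ^ (-((2 * k : ℕ) : ℝ)) with hS
  refine ⟨(k.factorial : ℝ) * Real.pi⁻¹ ^ k * S, fun δ hδ y hy ↦ ?_⟩
  have hy0 : ∀ w, 0 < y w := fun w ↦ hδ.trans_le (hy w)
  have hsum := summable_mixedGaussian_idealLattice K I hy0
  -- split off the term `x = 0`, where the Gaussian is `1`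
  have h0 : mixedGaussian K y ((0 : L) : mixedEmbedding.mixedSpace K) = 1 := by
    simp [mixedGaussian]
  rw [hsum.tsum_eq_add_tsum_ite 0, h0, add_sub_cancel_left]
  -- bound the remaining terms by the lattice `p`-series
  have hb : ∀ x : L, (if x = 0 then 0 else mixedGaussian K y (x : mixedEmbedding.mixedSpace K)) ≤
      (k.factorial : ℝ) * (Real.pi * δ)⁻¹ ^ k * ‖x‖ ^ (-((2 * k : ℕ) : ℝ)) := by
    intro x
    split_ifs with hx
    · subst hx
      have h2k : ((2 * k : ℕ) : ℝ) ≠ 0 := Nat.cast_ne_zero.mpr (by omega)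
      rw [norm_zero, Real.zero_rpow (neg_ne_zero.mpr h2k), mul_zero]
    · exact mixedGaussian_le_mul_norm_rpow K hδ hy (fun h ↦ hx (Subtype.ext h)) k
  have hsum' : Summable fun x : L ↦
      (if x = 0 then 0 else mixedGaussian K y (x : mixedEmbedding.mixedSpace K)) := by
    refine (hsum.update 0 0).congr fun x ↦ ?_
    simp only [Function.update_apply]
  calc ∑' x : L, (if x = 0 then 0 else mixedGaussian K y (x : mixedEmbedding.mixedSpace K))
      ≤ ∑' x : L, (k.factorial : ℝ) * (Real.pi * δ)⁻¹ ^ k * ‖x‖ ^ (-((2 * k : ℕ) : ℝ)) :=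
        Summable.tsum_le_tsum hb hsum' ((summable_norm_rpow_idealLattice K I hk).mul_left _)
    _ = (k.factorial : ℝ) * Real.pi⁻¹ ^ k * S * δ⁻¹ ^ k := by
        rw [tsum_mul_left, mul_inv, mul_pow]; ring

/-! ### Back to the ideal: `θ_𝔞` as a lattice sum -/

/-- The bijection `a ↦ j(a)` between a nonzero fractional ideal `𝔞` and its image lattice
`j(𝔞) = mixedEmbedding.idealLattice K 𝔞` in the Minkowski space (`j` is injective,
Mathlib `NumberField.mixedEmbedding_injective`). [folklore] -/
def idealEquivIdealLattice (I : (FractionalIdeal (𝓞 K)⁰ K)ˣ) :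
    (I : FractionalIdeal (𝓞 K)⁰ K) ≃ mixedEmbedding.idealLattice K I :=
  Equiv.ofBijective
    (fun a ↦ ⟨mixedEmbedding K (a : K), (mixedEmbedding.mem_idealLattice K I).mpr ⟨a, a.2, rfl⟩⟩)
    ⟨fun a b hab ↦ Subtype.ext (NumberField.mixedEmbedding_injective K (congr_arg Subtype.val hab)),
      fun x ↦ by
        obtain ⟨a, ha, hx⟩ := (mixedEmbedding.mem_idealLattice K I).mp x.2
        exact ⟨⟨a, ha⟩, Subtype.ext hx⟩⟩

/-- `idealEquivIdealLattice` is `a ↦ j(a)` on underlying points. [folklore] -/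
@[simp] theorem coe_idealEquivIdealLattice_apply (I : (FractionalIdeal (𝓞 K)⁰ K)ˣ)
    (a : (I : FractionalIdeal (𝓞 K)⁰ K)) :
    (idealEquivIdealLattice K I a : mixedEmbedding.mixedSpace K) = mixedEmbedding K (a : K) := rfl

/-- `θ_𝔞(iy)` is the sum of the Minkowski-space Gaussian over the ideal lattice `j(𝔞)` (this is
how Neukirch reads Definition VII (3.4) for `Γ = 𝔞` in §5). [folklore] -/
theorem thetaIdeal_eq_tsum_mixedGaussian (I : (FractionalIdeal (𝓞 K)⁰ K)ˣ)
    (y : InfinitePlace K → ℝ) :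
    thetaIdeal K I y = ∑' x : mixedEmbedding.idealLattice K I,
      mixedGaussian K y (x : mixedEmbedding.mixedSpace K) := by
  rw [thetaIdeal, ← (idealEquivIdealLattice K I).tsum_eq]
  simp only [coe_idealEquivIdealLattice_apply, thetaSummand_eq_mixedGaussian]
  exact tsum_congr fun _ ↦ rfl

/-- **Convergence of the theta series** (Neukirch VII (3.5) Proposition, for the lattice `Γ = 𝔞`
and `z = iy`): for `y ∈ R_+^*`, i.e. `y_w > 0` for all `w`, the series
`θ_𝔞(iy) = ∑_{a ∈ 𝔞} e^{-π⟨ay,a⟩}` converges (absolutely; all terms are positive).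
[cite: NeukirchANT1999, Ch. VII (3.5)] -/
def summable_thetaIdeal : Prop :=
  ∀ (I : FractionalIdeal (𝓞 K)⁰ K) (y : InfinitePlace K → ℝ), (∀ w, 0 < y w) →
    Summable fun a : I ↦ thetaSummand K y (a : K)

/-- Discharge of `summable_thetaIdeal` (Neukirch VII (3.5) for `Γ = 𝔞`, `z = iy`): transport of
`summable_mixedGaussian_idealLattice` along `a ↦ j(a)`; the zero ideal has the single term `1`.
[cite: NeukirchANT1999, Ch. VII (3.5)] -/
theorem summable_thetaIdeal_holds : summable_thetaIdeal K := by
  classical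
  intro I y hy
  by_cases hI : I = 0
  · subst hI
    have h0 : ∀ a : (0 : FractionalIdeal (𝓞 K)⁰ K), (a : K) = 0 := fun a ↦
      (FractionalIdeal.mem_zero_iff (𝓞 K)⁰).mp a.2
    haveI : Subsingleton (0 : FractionalIdeal (𝓞 K)⁰ K) :=
      ⟨fun a b ↦ Subtype.ext ((h0 a).trans (h0 b).symm)⟩
    exact .of_finite
  lift I to (FractionalIdeal (𝓞 K)⁰ K)ˣ using Ne.isUnit hI
  have h := summable_mixedGaussian_idealLattice K I hy
  rw [← (idealEquivIdealLattice K I).summable_iff] at h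
  refine h.congr fun a ↦ ?_
  simp only [Function.comp_apply, coe_idealEquivIdealLattice_apply, thetaSummand_eq_mixedGaussian]

/-- The theta series is antitone in `y > 0`: `y ≤ y'` coordinatewise gives
`θ_𝔞(iy') ≤ θ_𝔞(iy)`. [folklore] -/
theorem thetaIdeal_le_thetaIdeal (I : FractionalIdeal (𝓞 K)⁰ K) {y y' : InfinitePlace K → ℝ}
    (hy : ∀ w, 0 < y w) (h : ∀ w, y w ≤ y' w) : thetaIdeal K I y' ≤ thetaIdeal K I y := by
  refine Summable.tsum_le_tsum (fun a ↦ ?_) (summable_thetaIdeal_holds K I y' fun w ↦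
    (hy w).trans_le (h w)) (summable_thetaIdeal_holds K I y hy)
  rw [thetaSummand_eq_mixedGaussian, thetaSummand_eq_mixedGaussian]
  exact mixedGaussian_le_mixedGaussian K h _

/-- `θ_𝔞(iy) ≥ 1` for `y > 0` (the term `a = 0`). [folklore] -/
theorem one_le_thetaIdeal (I : FractionalIdeal (𝓞 K)⁰ K) {y : InfinitePlace K → ℝ}
    (hy : ∀ w, 0 < y w) : 1 ≤ thetaIdeal K I y := by
  classical
  have hs := summable_thetaIdeal_holds K I y hy
  rw [thetaIdeal, hs.tsum_eq_add_tsum_ite ⟨0, FractionalIdeal.zero_mem I⟩]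
  have h0 : ((⟨0, FractionalIdeal.zero_mem I⟩ : I) : K) = 0 := rfl
  rw [h0, thetaSummand_zero, le_add_iff_nonneg_right]
  exact tsum_nonneg fun a ↦ by split_ifs <;> [exact le_rfl; exact (thetaSummand_pos y _).le]

/-- **Decay of `θ_𝔞(iy) - 1`**: for a nonzero fractional ideal `𝔞` and `2k > n` there is `C`
with `θ_𝔞(iy) - 1 ≤ C δ^{-k}` whenever `y ≥ δ > 0` coordinatewise (polynomial form of
`θ - 1 = O(e^{-c t^{1/n}})`, proof of Neukirch VII (5.8)). [folklore] -/
theorem thetaIdeal_sub_one_le (I : FractionalIdeal (𝓞 K)⁰ K) (hI : I ≠ 0) {k : ℕ}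
    (hk : Module.finrank ℚ K < 2 * k) :
    ∃ C : ℝ, ∀ (δ : ℝ) (_ : 0 < δ) (y : InfinitePlace K → ℝ) (_ : ∀ w, δ ≤ y w),
      thetaIdeal K I y - 1 ≤ C * δ⁻¹ ^ k := by
  lift I to (FractionalIdeal (𝓞 K)⁰ K)ˣ using Ne.isUnit hI
  obtain ⟨C, hC⟩ := tsum_mixedGaussian_idealLattice_sub_one_le K I hk
  refine ⟨C, fun δ hδ y hy ↦ ?_⟩
  rw [thetaIdeal_eq_tsum_mixedGaussian K I]
  exact hC δ hδ y hy

/-- **Theta transformation formula for ideals** (NAMED FACT; Neukirch VII (3.6) for the lattice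
`Γ = 𝔞 ⊂ K_ℝ` at `z = iy` — so that `-1/z = i y⁻¹` and `N(z/i) = N(y)` —, with the dual lattice
`*Γ' = (𝔞𝔡)⁻¹` ((5.7) Lemma, `𝔡` the different), `θ_{Γ'} = θ_{*Γ'}`, and
`vol(𝔞) = 𝔑(𝔞) |d_K|^{1/2}` (Ch. I (5.2)), as combined in the proof of (5.8)):
for every nonzero fractional ideal `𝔞` and `y ∈ R_+^*`,
`θ_𝔞(i y⁻¹) = N(y)^{1/2} / (𝔑(𝔞) √|d_K|) · θ_{(𝔞𝔡)⁻¹}(iy)`.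
Here `(𝔞𝔡)⁻¹ = {x ∈ K | Tr_{K/ℚ}(x𝔞) ⊆ ℤ}` is Mathlib's `FractionalIdeal.dual ℤ ℚ 𝔞`
(`FractionalIdeal.mem_dual`; `= 𝔡⁻¹𝔞⁻¹` by `FractionalIdeal.dual_eq_mul_inv`,
`coeIdeal_differentIdeal`),
`𝔑 = FractionalIdeal.absNorm`, `d_K = NumberField.discr K`, `N(y) = mixedNorm K y`.
[cite: NeukirchANT1999, Ch. VII (3.6), (5.7), proof of (5.8)] -/
def thetaIdeal_inv : Prop :=
  ∀ (I : FractionalIdeal (𝓞 K)⁰ K) (_hI : I ≠ 0) (y : InfinitePlace K → ℝ) (_hy : ∀ w, 0 < y w),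
    thetaIdeal K I (fun w ↦ (y w)⁻¹) =
      Real.sqrt (mixedNorm K y) / ((FractionalIdeal.absNorm I : ℝ) * Real.sqrt |(discr K : ℝ)|) *
        thetaIdeal K (FractionalIdeal.dual ℤ ℚ I) y

end NumberField

end Literature.NumberTheory.LFunctions
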